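import Summits.CriticalPhenomena.PercolationContinuityZ3.Theorems.Transplant.SkelConcFaceContact
import Summits.CriticalPhenomena.PercolationContinuityZ3.Theorems.Transplant.SkelConcKitsRoom
import Summits.CriticalPhenomena.PercolationContinuityZ3.Theorems.Transplant.SkelConcRootClauses
import HarnessLib

/-!
# Kozma–Nitzan Lemma 11 over a planar skeleton — the INNER KIT CLAUSES of the face step's elongated route (hp-8 (F) part D; generic twin of the
# product's `BoxProdZ2ConcFaceRoute.innerKits`)

builds on p205010 (kernel theorem, internal audit signed; external expert review pending) — nothing in this file uses p205010.
Lane `prim-bschramm`, typed by the `prim-hp-8` lineage (gen 24); helper file (`--supports stmt-CriticalPhenomena-4575 --as helper`).  NEW FILE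
over `SkelConcKitsRoom` (`SkelI.kitClause_cube'`, `hcon_win₂_of_piece'`), `SkelConcFaceRoute` (`isSubbox_routeW_stepDR`), `SkelConcFaceInnerRoute`
(`innerWAD`, `innerWAD_level_subset`), `SkelWinChainTAR` (`WinAdvData.roomR`), p2-g5's `SkelConcRootClauses` (`φ_cubeCtr_mem_levelBox`; the
pattern of `hkits_rootWAD`).

**`innerKits'`** — the hypothesis `hkitsA` of `Skel.innerRoute_link_lt` / `hroute_face'` DISCHARGED: for every inner step `k ≤ nA` and level
`j' ∈ [j₀, j₁]` (`T₀ ≤ j₀`) of the rooted straight run `innerWAD … o L_A L'_A …` under the route law `routeW Wt Qt (fatSeq o mₛ)` in the inner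
window graph `winGraph G o L_A`, the 8-conjunct kit clause — from the Step-I input family (margin `am ≤ δ²`), the seed-kit constants, the counts,
the route scales `[ℓ₀, ℓ₁A] ⊆ Ssc` (`s₁ + R' ≤ ℓ₁A`, `ψ ℓ₁A + ψ M ≤ L'_A`, `r₀ ≤ L'_A ≤ L_A`), the planar rooms of the rooted run
(`WinAdvData.roomR`, orthant faces via `orthantFace_eq_piece`) and the subbox property of the route law (`isSubbox_routeW_stepDR`).
[cite: KozmaNitzan2024, §4 Lemma 10 Steps III–IV (pp. 19–21), Lemma 11 (pp. 22–23)]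
-/

noncomputable section

open MeasureTheory
open scoped Classical

namespace Summit.CriticalPhenomena.PercolationContinuityZ3.Theorems

namespace Transplant

namespace Skel

open Literature.Probability.Percolation Literature.Probability.LatticeModels SimpleGraph KNLevels KNCells ChainPlanar
open Literature.Probability.Percolation.KozmaNitzan
open Literature.Probability.Percolation.KozmaNitzan.Cells (oth oth_ne eq_oth_of_ne sgOf sgOf_sign stepVec_apply_fst stepVec_apply_oth)
open Literature.Probability.Percolation.GM (HOct piece)
open Literature.Barriers.CriticalPhenomena (graphBall graphBall_finite mem_graphBall_self graphBall_mono)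
open BoxProdZ2 (ConcRadiiG InnerRunOK innerCtr innerρ innerCtr_fst innerCtr_oth sg_mul_sub_add innerRun_advOK)
open PlanarSkeletonConc
open SkelI (tanOff deepCtr exitDir cubeU)

variable {V : Type} [DecidableEq V] {G : SimpleGraph V} [G.LocallyFinite] (Φ : PlanarSkeletonConc G)

/-- **The inner kit clauses of the elongated route under the route law** (see the module docstring).
[cite: KozmaNitzan2024, §4 Lemma 10 Steps III–IV (pp. 19–21), Lemma 11 (pp. 22–23)] -/
theorem innerKits' [Countable V] {C : PCells} {x : Site 2} {du : MDir} {o : V} {L_A L'_A : ℕ} {ca cb q' s₁ : ℤ}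
    {R' ℓ₀ nA Rlev N j₀ j₁ : ℕ} {Sfin : Finset V} {j : ℕ} (h : InnerRunOK C j s₁ R' ℓ₀ nA ca cb q') (hRl : Rlev + 1 ≤ R') (hj : j₁ ≤ Rlev)
    {p₀ : unitInterval} (hC : Φ.toPlanarSkeleton.CylSubcritical p₀) {mₛ ℓ1 : ℕ} (hsep : C.lev du x (Φ.φ o) + mₛ < ca - (s₁ + 2 * R'))
    {w₀ : V} {R : ℕ} {Wt : Sym2 V → unitInterval} {q : unitInterval} {Rg : Finset V} (hWD : IsSubbox (winGraph G w₀ R) Wt q Rg)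
    (hRg : ∀ u ∈ Rg, u ∈ graphBall G w₀ R) (hWG : ∀ e, e ∉ G.edgeSet → Wt e = 0)
    (hQ : innerQt Φ C x du o L_A s₁ R' nA ca cb q' (Φ.φ o) ℓ1 ⊆ Rg)
    -- the Step-I input family at the running parameter (margin `am ≤ δ²`), kit scale `M`, route scales `[ℓ₀, ℓ₁A] ⊆ Ssc`
    (msel : V → ℕ) {Ssc : Finset ℕ} {δ am : ℝ} (hδ : 0 < δ) (ham : am ≤ δ ^ 2)
    (hin : ∀ i ∈ inputIndex Φ Ssc, 1 - am < (bondPercolation G q).real (inputEvent Φ hC msel i))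
    {M : ℕ} (hM : M ∈ Ssc) (hmsel : ∀ t ∈ Φ.types, msel t ≤ M) (hMℓ₀ : M < ℓ₀) {ℓ₁A : ℕ} (hℓ₁A : s₁ + R' ≤ ℓ₁A)
    (hSsc : ∀ ℓ, ℓ₀ ≤ ℓ → ℓ ≤ ℓ₁A → ℓ ∈ Ssc)
    -- the seed-kit constants, the level window above `T₀`, the rim width
    {ℓs Rsd r₀ rs kk : ℕ} (hMℓ : M + 1 ≤ ℓs) (hj₀ : tanOff ℓs M ≤ j₀)
    (hR'₁ : Φ.cylRadMax ℓs (ℓs + 2 + 2 * tanOff ℓs M) ≤ Rsd) (hR'₂ : Φ.cylRadMax ℓs (ℓs + 2 + M + fatRadius Φ hC M) ≤ Rsd)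
    (hr₀₁ : ℓs + 1 + tanOff ℓs M + Rsd ≤ r₀) (hr₀₂ : 2 * ℓs + 2 + tanOff ℓs M + M + fatRadius Φ hC M ≤ r₀) (hr₀L : r₀ ≤ L'_A)
    (hrs₁ : ℓs + 2 + tanOff ℓs M + Rsd ≤ rs) (hrs₂ : 2 * ℓs + 3 + tanOff ℓs M + M + fatRadius Φ hC M ≤ rs)
    (hLψ : fatRadius Φ hC ℓ₁A + fatRadius Φ hC M ≤ L'_A) (hLR : L'_A ≤ L_A)
    (hN : kk * (Φ.Δ + 1) ^ (2 * rs) ≤ N)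
    (hk : (1 - (q : ℝ) ^ (1 + Φ.Δ * ((Φ.Δ + 1) ^ Rsd + (tanOff ℓs M + 2)) +
      ((Φ.Δ + 1) ^ Rsd + (tanOff ℓs M + 2)) * (Φ.Δ + 1) ^ fatRadius Φ hC M)) ^ kk ≤ δ) :
    ∀ k ≤ nA, ∀ j' ∈ Finset.Icc j₀ j₁, ∃ (σ : SData V) (Sz : Finset V),
      SHyp (winLData Φ o L_A ((innerWAD Φ C x du o L_A L'_A ca cb q' s₁ R' ℓ₀ nA Rlev N j₀ j₁ Sfin).alo k)
        ((innerWAD Φ C x du o L_A L'_A ca cb q' s₁ R' ℓ₀ nA Rlev N j₀ j₁ Sfin).ahi k) o Sfin) j' σ ∧ σ.N ≤ N ∧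
      (1 - (q : ℝ) ^ σ.sB) ^ σ.k ≤ δ ∧
      Sz ⊆ (winLData Φ o L_A ((innerWAD Φ C x du o L_A L'_A ca cb q' s₁ R' ℓ₀ nA Rlev N j₀ j₁ Sfin).alo k)
        ((innerWAD Φ C x du o L_A L'_A ca cb q' s₁ R' ℓ₀ nA Rlev N j₀ j₁ Sfin).ahi k) o Sfin).X j' ∧
      Sz ⊆ (innerWAD Φ C x du o L_A L'_A ca cb q' s₁ R' ℓ₀ nA Rlev N j₀ j₁ Sfin).stepDR Φ k ∧
      (∀ y ∈ σ.K, ∀ e ∈ σ.seed y, e ∉ wireSet (↑Sz : Set V)) ∧ (∀ y ∈ σ.K, σ.face y ⊆ Sz) ∧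
      (∀ y ∈ σ.K, 1 - 3 * δ ≤ (prodBernoulli (routeW G Wt (innerQt Φ C x du o L_A s₁ R' nA ca cb q' (Φ.φ o) ℓ1) (fatSeq Φ hC o mₛ))).real {ω | ∃ u ∈ σ.face y,
        1 - δ < (prodBernoulli (pinW (routeW G Wt (innerQt Φ C x du o L_A s₁ R' nA ca cb q' (Φ.φ o) ℓ1) (fatSeq Φ hC o mₛ)) (wireSet (↑Sz : Set V)) ω)).real
          (⋃ z ∈ (innerWAD Φ C x du o L_A L'_A ca cb q' s₁ R' ℓ₀ nA Rlev N j₀ j₁ Sfin).coreE Φ k,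
            openConnIn (↑((innerWAD Φ C x du o L_A L'_A ca cb q' s₁ R' ℓ₀ nA Rlev N j₀ j₁ Sfin).stepDR Φ k) : Set V) u z)}) := by
  intro k hk' j' hj'
  have hj'0 : j₀ ≤ j' := (Finset.mem_Icc.1 hj').1
  have hj'1 : j' ≤ j₁ := (Finset.mem_Icc.1 hj').2
  have hsg : (innerWAD Φ C x du o L_A L'_A ca cb q' s₁ R' ℓ₀ nA Rlev N j₀ j₁ Sfin).sg = 1 ∨ (innerWAD Φ C x du o L_A L'_A ca cb q' s₁ R' ℓ₀ nA Rlev N j₀ j₁ Sfin).sg = -1 := sgOf_sign du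
  have hOK := innerWAD_advOK Φ (x := x) (du := du) (o := o) (L_A := L_A) (L'_A := L'_A) (Rlev := Rlev) (N := N) (j₀ := j₀) (j₁ := j₁)
    (Sfin := Sfin) h
  have hRl' : (innerWAD Φ C x du o L_A L'_A ca cb q' s₁ R' ℓ₀ nA Rlev N j₀ j₁ Sfin).Rlev + 1 ≤ (innerWAD Φ C x du o L_A L'_A ca cb q' s₁ R' ℓ₀ nA Rlev N j₀ j₁ Sfin).R' := hRl
  have hjj : (innerWAD Φ C x du o L_A L'_A ca cb q' s₁ R' ℓ₀ nA Rlev N j₀ j₁ Sfin).j₁ ≤ (innerWAD Φ C x du o L_A L'_A ca cb q' s₁ R' ℓ₀ nA Rlev N j₀ j₁ Sfin).Rlev := hj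
  have hkP : k ≤ (innerWAD Φ C x du o L_A L'_A ca cb q' s₁ R' ℓ₀ nA Rlev N j₀ j₁ Sfin).nA := hk'
  have hR : r₀ ≤ L_A := hr₀L.trans hLR
  -- the rooted region is a subbox of the route law in the inner window graph; the level lies in it; the level box is wide
  have hWDi := isSubbox_routeW_stepDR Φ hC (L'_A := L'_A) (Rlev := Rlev) (N := N) (j₀ := j₀) (j₁ := j₁) (Sfin := Sfin) hWD hRg hWG hQ h hsep hk'
  have hXD : winLevel Φ o L_A ((innerWAD Φ C x du o L_A L'_A ca cb q' s₁ R' ℓ₀ nA Rlev N j₀ j₁ Sfin).alo k) ((innerWAD Φ C x du o L_A L'_A ca cb q' s₁ R' ℓ₀ nA Rlev N j₀ j₁ Sfin).ahi k) j' ⊆ (innerWAD Φ C x du o L_A L'_A ca cb q' s₁ R' ℓ₀ nA Rlev N j₀ j₁ Sfin).stepDR Φ k :=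
    innerWAD_level_subset Φ h hRl hk' (by omega)
  have hwide : ∀ i, ((innerWAD Φ C x du o L_A L'_A ca cb q' s₁ R' ℓ₀ nA Rlev N j₀ j₁ Sfin).alo k - (j' : Site 2)) i + 2 * tanOff ℓs M ≤ ((innerWAD Φ C x du o L_A L'_A ca cb q' s₁ R' ℓ₀ nA Rlev N j₀ j₁ Sfin).ahi k + (j' : Site 2)) i := by
    intro i
    have hle := (Finset.nonempty_Icc.1 (Adv.core_nonempty (sgOf_sign du) (innerCtr C x du ca cb) (innerRun_advOK h) k (a := du.1))) i
    have hjT : ((tanOff ℓs M : ℕ) : ℤ) ≤ j' := by exact_mod_cast hj₀.trans hj'0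
    change ((innerWAD Φ C x du o L_A L'_A ca cb q' s₁ R' ℓ₀ nA Rlev N j₀ j₁ Sfin).alo k) i ≤ ((innerWAD Φ C x du o L_A L'_A ca cb q' s₁ R' ℓ₀ nA Rlev N j₀ j₁ Sfin).ahi k) i at hle
    simp only [Pi.sub_apply, Pi.add_apply, Pi.natCast_apply]
    linarith
  -- the enlarged target: the true target over core (k+1), rim = the region's window vertices deeper than `L_A − L'_A`
  have hTpl : Φ.Win o ((innerWAD Φ C x du o L_A L'_A ca cb q' s₁ R' ℓ₀ nA Rlev N j₀ j₁ Sfin).acore (k + 1)) L_A ⊆ (innerWAD Φ C x du o L_A L'_A ca cb q' s₁ R' ℓ₀ nA Rlev N j₀ j₁ Sfin).coreE Φ k := Finset.subset_union_left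
  have hTrim : ∀ v ∈ winLevel Φ o L_A ((innerWAD Φ C x du o L_A L'_A ca cb q' s₁ R' ℓ₀ nA Rlev N j₀ j₁ Sfin).alo k) ((innerWAD Φ C x du o L_A L'_A ca cb q' s₁ R' ℓ₀ nA Rlev N j₀ j₁ Sfin).ahi k) j', v ∉ graphBall G o (L_A - L'_A) → v ∈ (innerWAD Φ C x du o L_A L'_A ca cb q' s₁ R' ℓ₀ nA Rlev N j₀ j₁ Sfin).coreE Φ k :=
    fun v hv hfar => Finset.mem_union_right _ (Finset.mem_filter.2 ⟨hXD hv, hfar⟩)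
  -- the per-contact dichotomy from the planar rooms of the rooted straight run (orthant faces)
  have hcon := SkelI.hcon_win₂_of_piece' Φ hC (msel := msel) (Ssc := Ssc) (q := q) (δ := δ) (rs := rs) (cU := (Φ.Δ + 1) ^ fatRadius Φ hC M)
    (Wt := (routeW G Wt (innerQt Φ C x du o L_A s₁ R' nA ca cb q' (Φ.φ o) ℓ1) (fatSeq Φ hC o mₛ))) (D := (innerWAD Φ C x du o L_A L'_A ca cb q' s₁ R' ℓ₀ nA Rlev N j₀ j₁ Sfin).stepDR Φ k) (T := (innerWAD Φ C x du o L_A L'_A ca cb q' s₁ R' ℓ₀ nA Rlev N j₀ j₁ Sfin).coreE Φ k) (Rt := L_A) (L'' := L'_A) (Ldeep := fatRadius Φ hC ℓ₁A)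
    (Unear := cubeU Φ hC o L_A ((innerWAD Φ C x du o L_A L'_A ca cb q' s₁ R' ℓ₀ nA Rlev N j₀ j₁ Sfin).alo k) ((innerWAD Φ C x du o L_A L'_A ca cb q' s₁ R' ℓ₀ nA Rlev N j₀ j₁ Sfin).ahi k) j' ℓs M) ham (fun _ _ _ => rfl)
    (SkelI.nearFaceOK_cube Φ hC hMℓ hwide hR'₂ hr₀₂ hR hrs₂ le_rfl) hTrim (Nat.sub_le_sub_left hr₀L L_A) hLψ hLR le_rfl hWDi
    (Dpl := (innerWAD Φ C x du o L_A L'_A ca cb q' s₁ R' ℓ₀ nA Rlev N j₀ j₁ Sfin).aregionR k) (Tpl := (innerWAD Φ C x du o L_A L'_A ca cb q' s₁ R' ℓ₀ nA Rlev N j₀ j₁ Sfin).acore (k + 1)) subset_rfl hTpl (fun x' hx' hnear => by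
      have hmem := φ_cubeCtr_mem_levelBox Φ hC (w₀ := o) hwide hr₀₂ hR hx' hnear
      obtain ⟨ℓ, hℓ₀, hℓ₁, hsq, a, τ', hface⟩ := WinAdvData.roomR (innerWAD Φ C x du o L_A L'_A ca cb q' s₁ R' ℓ₀ nA Rlev N j₀ j₁ Sfin) hsg hOK hRl' hjj (ℓ₁ := ℓ₁A)
        (by change 2 * (0 : ℤ) + (s₁ : ℤ) + R' ≤ ((ℓ₁A : ℕ) : ℤ); push_cast; linarith) hkP j' hj'1 _ hmem
      refine ⟨ℓ, hSsc ℓ hℓ₀ hℓ₁, lt_of_lt_of_le hMℓ₀ hℓ₀, fatRadius_mono Φ hC hℓ₁, hsq,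
        ((Equiv.swap 0 a, fun i => τ' (Equiv.swap 0 a i)) : HOct 2), ?_⟩
      rw [orthantFace_eq_piece] at hface
      exact hface)
  have hℓs : 1 ≤ ℓs := by omega
  exact SkelI.kitClause_cube' Φ hC msel hδ ham hin hM hmsel hMℓ hwide hR'₁ hR'₂ hr₀₁ hr₀₂ hR hrs₁ hrs₂ kk o Sfin hWDi hXD hN hk hcon

end Skel

end Transplant

end Summit.CriticalPhenomena.PercolationContinuityZ3.Theorems

end
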